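import Summits.Ventures.HSemireg.WedgeHankelSecantKernel

/-!
# Venture HSemireg — THE KERNEL DETERMINES THE NODES: `⋂_{i<r} F_{λ_i}(k) = ⋂_{j<s} F_{ν_j}(k) ⇒ {λ_i} = {ν_j}` (Torelli for secant classes),
# and a form killing `r` exponentials need not kill an `(r+1)`-th

HONEST FRAMING. Part of the Lean index of the computation cell `pub-hsemireg` (seat p10 gen 14, Sunday typer «UNIFORM-IN-n»).
Finite-dimensional EXTERIOR ALGEBRA over a field and ranks of HANKEL MATRICES ONLY: no variety, no cohomology theory, no sheaf, no Ext
group and no semiregularity map is constructed here; nothing here says that HC / HC_CM / HC_AV holds; no Literature fact is declared or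
used.  Custodian versions cited: theory/FORMULA-N.md PART A §2.6 THEOREM H and its KRONECKER DICTIONARY; STRUCTURE.md v1.0-SIGNED
9b196a05977dd067 §1.1 C15.  The dictionary (`Σ_i A_i exp(λ_i Θ)` ↦ `q_j = Σ_i A_i λ_i^j` ↦ `w_m(q)`) is QUOTED, never asserted.

WHAT IS KEYED.  D2 (`WedgeHankelSecantKernel`): THE SECANT KERNEL LAW `Kr(univ, w_m(Σ_{i<r} A_i λ_i^•), k) = ⋂_{i<r} F_{λ_i}(k)` and FRAMES IN
GENERAL POSITION `dim ⋂_{i<r} F_{λ_i}(k) + r·C(m,k) = C(2m,k)` (`r ≤ min(k+1, m+1−k)`, distinct slopes).  THIS FILE reads the node set back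
off the kernel:
* §1 restriction of an intersection of frames to a sub-family; appending one slope (`iInf_frameIdeal_snoc`).
* §2 **`iInf_frameIdeal_not_le_frameIdeal`: for `r + 1 ≤ k + 1`, `r + 1 ≤ m + 1 − k` (`k ≥ 1`), distinct `λ_i` and a further slope `μ ∉ {λ_i}`:
  `⋂_{i<r} F_{λ_i}(k) ⊄ F_μ(k)`** — the counts differ by `C(m,k) ≥ 1`; so **some degree-`k` form kills the `r` exponentials `exp(λ_i Θ)` but NOT
  `exp(μΘ)`** (`exists_mul_uprod_ne_zero`).  (At `r = k + 1` this stops: D3 — `k + 1` frames already give `SI_k`, which kills everything.)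
* §3 **TORELLI FOR FRAMES `range_eq_of_iInf_frameIdeal_eq`: two families of distinct slopes, of sizes `r, s` with `r + 1, s + 1 ≤ min(k+1, m+1−k)`, whose
  frame-ideal intersections in degree `k` coincide have the same node SET**; for secant classes (`Kr_w_secSeq_eq_imp_range_eq`): equal degree-`k` kernels
  ⇒ equal node sets, whatever the non-zero weights; pure classes (`r = s = 1`, `1 ≤ k ≤ m − 1`): **`Kr(univ, w_m(A λ^•), k) = Kr(univ, w_m(B μ^•), k)
  ⇒ λ = μ`** (`eq_of_Kr_w_expSeq_eq`) — the kernel of a line-bundle-type class determines its slope.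
* §4 COMPLEMENTS: **`frameIdeal_sup_iInf_frameIdeal_eq_Hom`: `F_μ(k) + ⋂_{i<r} F_{λ_i}(k) = Hom(univ, k)`** for a new slope `μ` (C10's
  `frameIdeal_sup_eq_Hom` is `r = 1`): every degree-`k` form splits as (one killing `exp(μΘ)`) + (one killing all `exp(λ_i Θ)`) (`exists_add_eq_of_mem_Hom`); two DISJOINT
  families with `r + s ≤ min(k+1, m+1−k)`: **`⋂_i F_{λ_i}(k) + ⋂_j F_{ν_j}(k) = Hom(univ, k)`** (`iInf_frameIdeal_sup_iInf_frameIdeal_eq_Hom`) — frames in general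
  position generate a BOOLEAN lattice (union of node sets ↦ intersection, disjoint node sets ↦ complementary sum).
Namespace `Summit.Ventures.HSemireg.Wedge.HankelSecant` (continued); new names only.
-/

open Module

namespace Summit.Ventures.HSemireg.Wedge.HankelSecant

open Summit.Ventures.HSemireg.Wedge Summit.Ventures.HSemireg.Wedge.Kunneth Summit.Ventures.HSemireg.Wedge.KunnethKernel
  Summit.Ventures.HSemireg.Wedge.HankelFaces Summit.Ventures.HSemireg.Wedge.HankelPureKernel

variable (K : Type*) [Field K] (m : ℕ)

/-! ## §1. Sub-families and appending a slope -/

/-- restricting to a sub-family enlarges the intersection: `⋂_{i<r} F_{λ_i} ≤ ⋂_{j<s} F_{λ_{g j}}` for any `g : Fin s → Fin r`. -/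
lemma iInf_frameIdeal_le_comp {r s : ℕ} (lam : Fin r → K) (g : Fin s → Fin r) (k : ℕ) :
    (⨅ i, frameIdeal K m (uvec K m (lam i)) k) ≤ ⨅ j, frameIdeal K m (uvec K m (lam (g j))) k :=
  le_iInf fun j => iInf_le _ (g j)

/-- appending one slope: `⋂_{i ≤ r} F_{(λ, μ)_i} = (⋂_{i<r} F_{λ_i}) ∩ F_μ`. -/
lemma iInf_frameIdeal_snoc {r : ℕ} (lam : Fin r → K) (mu : K) (k : ℕ) :
    (⨅ i : Fin (r + 1), frameIdeal K m (uvec K m ((Fin.snoc lam mu : Fin (r + 1) → K) i)) k) =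
      (⨅ i, frameIdeal K m (uvec K m (lam i)) k) ⊓ frameIdeal K m (uvec K m mu) k := by
  apply le_antisymm
  · refine le_inf (le_iInf fun i => ?_) ?_
    · have h := iInf_le (fun i : Fin (r + 1) => frameIdeal K m (uvec K m ((Fin.snoc lam mu : Fin (r + 1) → K) i)) k) (Fin.castSucc i)
      rwa [Fin.snoc_castSucc] at h
    · have h := iInf_le (fun i : Fin (r + 1) => frameIdeal K m (uvec K m ((Fin.snoc lam mu : Fin (r + 1) → K) i)) k) (Fin.last r)
      rwa [Fin.snoc_last] at h
  · refine le_iInf fun j => ?_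
    refine Fin.lastCases ?_ (fun i => ?_) j
    · rw [Fin.snoc_last]; exact inf_le_right
    · rw [Fin.snoc_castSucc]; exact inf_le_left.trans (iInf_le _ i)

omit [Field K] in
/-- `Fin.snoc λ μ` is injective when `λ` is and `μ` is a new slope. -/
lemma snoc_injective {r : ℕ} {lam : Fin r → K} (hlam : Function.Injective lam) {mu : K} (hmu : ∀ i, lam i ≠ mu) :
    Function.Injective (Fin.snoc lam mu : Fin (r + 1) → K) := by
  intro a b hab
  induction a using Fin.lastCases with
  | last =>
    induction b using Fin.lastCases with
    | last => rfl
    | cast j => rw [Fin.snoc_last, Fin.snoc_castSucc] at hab; exact absurd hab.symm (hmu j)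
  | cast i =>
    induction b using Fin.lastCases with
    | last => rw [Fin.snoc_last, Fin.snoc_castSucc] at hab; exact absurd hab (hmu i)
    | cast j => rw [Fin.snoc_castSucc, Fin.snoc_castSucc] at hab; rw [hlam hab]

/-! ## §2. A form killing `r` exponentials need not kill another -/

/-- **`⋂_{i<r} F_{λ_i}(k) ⊄ F_μ(k)`** for a NEW slope `μ` (`1 ≤ r`, distinct `λ_i`, `1 ≤ k`, `r + 1 ≤ k + 1`, `r + 1 ≤ m + 1 − k`): by FRAMES IN GENERAL
POSITION the two intersections have dimensions differing by `C(m,k) ≥ 1`. -/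
theorem iInf_frameIdeal_not_le_frameIdeal {r k : ℕ} (hr : 0 < r) (hk : 1 ≤ k) (hrk : r + 1 ≤ k + 1) (hrm : r + 1 ≤ m + 1 - k)
    {lam : Fin r → K} (hlam : Function.Injective lam) {mu : K} (hmu : ∀ i, lam i ≠ mu) :
    ¬ (⨅ i, frameIdeal K m (uvec K m (lam i)) k) ≤ frameIdeal K m (uvec K m mu) k := by
  intro hle
  have key : finrank K ↥(⨅ i, frameIdeal K m (uvec K m (lam i)) k) + (r + 1) * m.choose k = (m + m).choose k := by
    have h1 := finrank_iInf_frameIdeal_add K m (Nat.succ_pos r) hk hrk hrm (snoc_injective K hlam hmu)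
    rw [iInf_frameIdeal_snoc, inf_eq_left.mpr hle] at h1
    convert h1 using 2
  have h0 := finrank_iInf_frameIdeal_add K m hr hk (by omega) (by omega) hlam
  have h5 : 1 ≤ m.choose k := Nat.choose_pos (by omega)
  have e : (r + 1) * m.choose k = r * m.choose k + m.choose k := by ring
  omega

/-- hence **some degree-`k` form kills the `r` exponentials `exp(λ_i Θ)` but NOT `exp(μΘ)`** (same hypotheses). -/
theorem exists_mul_uprod_ne_zero {r k : ℕ} (hr : 0 < r) (hk : 1 ≤ k) (hrk : r + 1 ≤ k + 1) (hrm : r + 1 ≤ m + 1 - k)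
    {lam : Fin r → K} (hlam : Function.Injective lam) {mu : K} (hmu : ∀ i, lam i ≠ mu) :
    ∃ θ ∈ Hom K (Hankel.In m) Finset.univ k, (∀ i, θ * uprod K m (lam i) m = 0) ∧ θ * uprod K m mu m ≠ 0 := by
  obtain ⟨θ, hθ, hθmu⟩ := Set.not_subset.mp (iInf_frameIdeal_not_le_frameIdeal K m hr hk hrk hrm hlam hmu)
  have hθ' : θ ∈ ⨅ i, frameIdeal K m (uvec K m (lam i)) k := hθ
  have hH : θ ∈ Hom K (Hankel.In m) Finset.univ k := iInf_frameIdeal_le_Hom K m hr lam hk hθ'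
  refine ⟨θ, hH, fun i => ?_, fun h0 => hθmu ?_⟩
  · have hi := (Submodule.mem_iInf _).mp hθ' i
    rw [← Kr_w_expSeq K m one_ne_zero (lam i) hk, mem_Kr, w_expSeq, one_smul] at hi
    exact hi.2
  · show θ ∈ frameIdeal K m (uvec K m mu) k
    rw [← Kr_w_expSeq K m one_ne_zero mu hk, mem_Kr, w_expSeq, one_smul]
    exact ⟨hH, h0⟩

/-! ## §3. Torelli: the kernel determines the node set -/

/-- if `⋂_{i<r} F_{λ_i}(k) ≤ ⋂_j F_{ν_j}(k)` (hypotheses as in §2 on the `λ`-family) then **every `ν_j` is one of the `λ_i`**. -/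
theorem mem_range_of_iInf_frameIdeal_le {r s k : ℕ} (hr : 0 < r) (hk : 1 ≤ k) (hrk : r + 1 ≤ k + 1) (hrm : r + 1 ≤ m + 1 - k)
    {lam : Fin r → K} (hlam : Function.Injective lam) {nu : Fin s → K}
    (hle : (⨅ i, frameIdeal K m (uvec K m (lam i)) k) ≤ ⨅ j, frameIdeal K m (uvec K m (nu j)) k) (j : Fin s) : nu j ∈ Set.range lam := by
  by_contra hj
  exact iInf_frameIdeal_not_le_frameIdeal K m hr hk hrk hrm hlam (fun i h => hj ⟨i, h⟩) (hle.trans (iInf_le _ j))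

/-- **TORELLI FOR FRAMES: two families of distinct slopes (sizes `r, s ≥ 1`, `r + 1, s + 1 ≤ min(k+1, m+1−k)`, `k ≥ 1`) with the same degree-`k`
intersection of frame ideals have the same NODE SET.** -/
theorem range_eq_of_iInf_frameIdeal_eq {r s k : ℕ} (hk : 1 ≤ k) (hr : 0 < r) (hrk : r + 1 ≤ k + 1) (hrm : r + 1 ≤ m + 1 - k) (hs : 0 < s)
    (hsk : s + 1 ≤ k + 1) (hsm : s + 1 ≤ m + 1 - k) {lam : Fin r → K} (hlam : Function.Injective lam) {nu : Fin s → K}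
    (hnu : Function.Injective nu) (heq : (⨅ i, frameIdeal K m (uvec K m (lam i)) k) = ⨅ j, frameIdeal K m (uvec K m (nu j)) k) :
    Set.range lam = Set.range nu := by
  apply Set.Subset.antisymm
  · rintro _ ⟨i, rfl⟩
    exact mem_range_of_iInf_frameIdeal_le K m hs hk hsk hsm hnu heq.symm.le i
  · rintro _ ⟨j, rfl⟩
    exact mem_range_of_iInf_frameIdeal_le K m hr hk hrk hrm hlam heq.le j

/-- **TORELLI FOR SECANT CLASSES: equal degree-`k` kernels ⇒ equal node sets**, whatever the non-zero weights (same size hypotheses). -/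
theorem Kr_w_secSeq_eq_imp_range_eq {r s k : ℕ} (hk : 1 ≤ k) (hr : 0 < r) (hrk : r + 1 ≤ k + 1) (hrm : r + 1 ≤ m + 1 - k) (hs : 0 < s)
    (hsk : s + 1 ≤ k + 1) (hsm : s + 1 ≤ m + 1 - k) {A lam : Fin r → K} (hA : ∀ i, A i ≠ 0) (hlam : Function.Injective lam)
    {B nu : Fin s → K} (hB : ∀ j, B j ≠ 0) (hnu : Function.Injective nu)
    (heq : Kr K Finset.univ (Hankel.w K m m (secSeq K A lam)) k = Kr K Finset.univ (Hankel.w K m m (secSeq K B nu)) k) :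
    Set.range lam = Set.range nu := by
  rw [Kr_w_secSeq K m hr hk (by omega) (by omega) hA hlam, Kr_w_secSeq K m hs hk (by omega) (by omega) hB hnu] at heq
  exact range_eq_of_iInf_frameIdeal_eq K m hk hr hrk hrm hs hsk hsm hlam hnu heq

/-- the pure case: **the kernel of a line-bundle-type class determines its slope — `Kr(univ, w_m(Aλ^•), k) = Kr(univ, w_m(Bμ^•), k) ⇒ λ = μ`**
(`A, B ≠ 0`, `1 ≤ k ≤ m − 1`). -/
theorem eq_of_Kr_w_expSeq_eq {k : ℕ} (hk : 1 ≤ k) (hkm : k + 1 ≤ m) {A B lam mu : K} (hA : A ≠ 0) (hB : B ≠ 0)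
    (heq : Kr K Finset.univ (Hankel.w K m m (expSeq K A lam)) k = Kr K Finset.univ (Hankel.w K m m (expSeq K B mu)) k) : lam = mu := by
  rw [Kr_w_expSeq K m hA lam hk, Kr_w_expSeq K m hB mu hk] at heq
  by_contra hne
  refine iInf_frameIdeal_not_le_frameIdeal K m (r := 1) one_pos hk (by omega) (by omega) (lam := fun _ => lam)
    (Function.injective_of_subsingleton _) (mu := mu) (fun _ => hne) ?_
  have e : (⨅ i : Fin 1, frameIdeal K m (uvec K m ((fun _ : Fin 1 => lam) i)) k) = frameIdeal K m (uvec K m lam) k := iInf_const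
  rw [e, heq]

/-- equivalently for frames: **`F_λ(k) = F_μ(k) ⇒ λ = μ`** (`1 ≤ k ≤ m − 1`): distinct slopes have distinct frame ideals in every such degree. -/
theorem frameIdeal_injective {k : ℕ} (hk : 1 ≤ k) (hkm : k + 1 ≤ m) :
    Function.Injective fun lam : K => frameIdeal K m (uvec K m lam) k := by
  intro lam mu h
  apply eq_of_Kr_w_expSeq_eq K m hk hkm one_ne_zero one_ne_zero
  rw [Kr_w_expSeq K m one_ne_zero lam hk, Kr_w_expSeq K m one_ne_zero mu hk]
  exact h

/-! ## §4. Complements: one more frame fills up everything -/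

/-- `dim Hom(univ, k) = C(2m, k)` on th-7's model (private copy). -/
private lemma finrank_Hom_univ₉ (k : ℕ) : finrank K (Hom K (Hankel.In m) Finset.univ k) = (m + m).choose k := by
  rw [Hom_univ_eq_exteriorPower, exteriorPower.finrank_eq, finrank_fintype_fun_eq_card, Fintype.card_fin]

/-- **`F_μ(k) + ⋂_{i<r} F_{λ_i}(k) = Hom(univ, k)`** for a NEW slope `μ` (`1 ≤ r`, `r + 1 ≤ k + 1`, `r + 1 ≤ m + 1 − k`, distinct `λ_i`): every degree-`k`
form is the sum of one killing `exp(μΘ)` and one killing all the `exp(λ_i Θ)` — C10's `frameIdeal_sup_eq_Hom` is the case `r = 1`; by general position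
the dimensions of the sum add up to `C(2m,k)`. -/
theorem frameIdeal_sup_iInf_frameIdeal_eq_Hom {r k : ℕ} (hr : 0 < r) (hk : 1 ≤ k) (hrk : r + 1 ≤ k + 1) (hrm : r + 1 ≤ m + 1 - k)
    {lam : Fin r → K} (hlam : Function.Injective lam) {mu : K} (hmu : ∀ i, lam i ≠ mu) :
    frameIdeal K m (uvec K m mu) k ⊔ (⨅ i, frameIdeal K m (uvec K m (lam i)) k) = Hom K (Hankel.In m) Finset.univ k := by
  apply Submodule.eq_of_le_of_finrank_le
  · exact sup_le (by rw [← Kr_w_expSeq K m one_ne_zero mu hk]; exact Kr_le_Hom K _ _ _) (iInf_frameIdeal_le_Hom K m hr lam hk)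
  · have key := Submodule.finrank_sup_add_finrank_inf_eq (frameIdeal K m (uvec K m mu) k) (⨅ i, frameIdeal K m (uvec K m (lam i)) k)
    have h1 := finrank_frameIdeal_uvec K m mu hk
    have h2 := finrank_iInf_frameIdeal_add K m hr hk (by omega) (by omega) hlam
    have h3 : finrank K ↥(frameIdeal K m (uvec K m mu) k ⊓ ⨅ i, frameIdeal K m (uvec K m (lam i)) k) + (r + 1) * m.choose k =
        (m + m).choose k := by
      have h := finrank_iInf_frameIdeal_add K m (Nat.succ_pos r) hk hrk hrm (snoc_injective K hlam hmu)
      rw [iInf_frameIdeal_snoc, inf_comm] at h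
      convert h using 2
    rw [finrank_Hom_univ₉]
    have hle : m.choose k ≤ (m + m).choose k := Nat.choose_le_choose k (by omega)
    have e : (r + 1) * m.choose k = r * m.choose k + m.choose k := by ring
    omega

/-- so **every degree-`k` form `θ` splits as `θ = θ_μ + θ_λ` with `θ_μ ∧ exp(μΘ)`'s class `= 0` and `θ_λ` killing all the `exp(λ_i Θ)`** (same hypotheses). -/
theorem exists_add_eq_of_mem_Hom {r k : ℕ} (hr : 0 < r) (hk : 1 ≤ k) (hrk : r + 1 ≤ k + 1) (hrm : r + 1 ≤ m + 1 - k)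
    {lam : Fin r → K} (hlam : Function.Injective lam) {mu : K} (hmu : ∀ i, lam i ≠ mu) {θ : HT K (Hankel.In m)}
    (hθ : θ ∈ Hom K (Hankel.In m) Finset.univ k) :
    ∃ θ₁ θ₂ : HT K (Hankel.In m), θ₁ * uprod K m mu m = 0 ∧ (∀ i, θ₂ * uprod K m (lam i) m = 0) ∧ θ = θ₁ + θ₂ := by
  rw [← frameIdeal_sup_iInf_frameIdeal_eq_Hom K m hr hk hrk hrm hlam hmu] at hθ
  obtain ⟨θ₁, h₁, θ₂, h₂, rfl⟩ := Submodule.mem_sup.mp hθ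
  refine ⟨θ₁, θ₂, ?_, fun i => ?_, rfl⟩
  · rw [← Kr_w_expSeq K m one_ne_zero mu hk, mem_Kr, w_expSeq, one_smul] at h₁
    exact h₁.2
  · have hi := (Submodule.mem_iInf _).mp h₂ i
    rw [← Kr_w_expSeq K m one_ne_zero (lam i) hk, mem_Kr, w_expSeq, one_smul] at hi
    exact hi.2

/-- the joint family of two disjoint families of slopes, on `Fin (r + s)`: its frame intersection is the intersection of the two. -/
lemma iInf_frameIdeal_sumElim {r s : ℕ} (lam : Fin r → K) (nu : Fin s → K) (k : ℕ) :
    (⨅ i : Fin (r + s), frameIdeal K m (uvec K m (Sum.elim lam nu (finSumFinEquiv.symm i))) k) =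
      (⨅ i, frameIdeal K m (uvec K m (lam i)) k) ⊓ ⨅ j, frameIdeal K m (uvec K m (nu j)) k := by
  apply le_antisymm
  · refine le_inf (le_iInf fun i => ?_) (le_iInf fun j => ?_)
    · have h := iInf_le (fun i : Fin (r + s) => frameIdeal K m (uvec K m (Sum.elim lam nu (finSumFinEquiv.symm i))) k)
        (finSumFinEquiv (Sum.inl i))
      rwa [Equiv.symm_apply_apply, Sum.elim_inl] at h
    · have h := iInf_le (fun i : Fin (r + s) => frameIdeal K m (uvec K m (Sum.elim lam nu (finSumFinEquiv.symm i))) k)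
        (finSumFinEquiv (Sum.inr j))
      rwa [Equiv.symm_apply_apply, Sum.elim_inr] at h
  · refine le_iInf fun x => ?_
    obtain ⟨y, rfl⟩ := finSumFinEquiv.surjective x
    rw [Equiv.symm_apply_apply]
    rcases y with i | j
    · rw [Sum.elim_inl]; exact inf_le_left.trans (iInf_le _ i)
    · rw [Sum.elim_inr]; exact inf_le_right.trans (iInf_le _ j)

/-- two DISJOINT families of distinct slopes, `r, s ≥ 1`, `r + s ≤ k + 1`, `r + s ≤ m + 1 − k`:
**`⋂_{i<r} F_{λ_i}(k) + ⋂_{j<s} F_{ν_j}(k) = Hom(univ, k)`** — frames in general position generate a BOOLEAN lattice: union of node sets ↦ intersection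
of ideals, disjoint node sets ↦ sums filling `Hom(univ, k)` (the previous theorem is `s = 1`). -/
theorem iInf_frameIdeal_sup_iInf_frameIdeal_eq_Hom {r s k : ℕ} (hr : 0 < r) (hs : 0 < s) (hk : 1 ≤ k) (hrsk : r + s ≤ k + 1)
    (hrsm : r + s ≤ m + 1 - k) {lam : Fin r → K} (hlam : Function.Injective lam) {nu : Fin s → K} (hnu : Function.Injective nu)
    (hdis : ∀ i j, lam i ≠ nu j) :
    (⨅ i, frameIdeal K m (uvec K m (lam i)) k) ⊔ (⨅ j, frameIdeal K m (uvec K m (nu j)) k) = Hom K (Hankel.In m) Finset.univ k := by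
  apply Submodule.eq_of_le_of_finrank_le
  · exact sup_le (iInf_frameIdeal_le_Hom K m hr lam hk) (iInf_frameIdeal_le_Hom K m hs nu hk)
  · have key := Submodule.finrank_sup_add_finrank_inf_eq (⨅ i, frameIdeal K m (uvec K m (lam i)) k) (⨅ j, frameIdeal K m (uvec K m (nu j)) k)
    have h1 := finrank_iInf_frameIdeal_add K m hr hk (by omega) (by omega) hlam
    have h2 := finrank_iInf_frameIdeal_add K m hs hk (by omega) (by omega) hnu
    have hinj : Function.Injective fun i : Fin (r + s) => Sum.elim lam nu (finSumFinEquiv.symm i) :=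
      (hlam.sumElim hnu hdis).comp finSumFinEquiv.symm.injective
    have h3 := finrank_iInf_frameIdeal_add K m (by omega : 0 < r + s) hk hrsk hrsm hinj
    rw [iInf_frameIdeal_sumElim] at h3
    rw [finrank_Hom_univ₉]
    have e : (r + s) * m.choose k = r * m.choose k + s * m.choose k := by ring
    omega

end Summit.Ventures.HSemireg.Wedge.HankelSecant
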